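import Summits.CriticalPhenomena.PercolationContinuityZ3.Theorems.PercNearOneGluingNoHeavyQuantFarGate3ChartDCertE
import HarnessLib

/-!
# QUANT lane R8, front "FAR beyond trees", layer one — THE DEGREE-THREE GATE AT THE OBSERVER, LIX-d: chart-D kernel — SOUNDNESS `ChartD.sound`

builds on p205010 (kernel theorem, internal audit signed; external expert review pending)

Support file (`--supports stmt-CriticalPhenomena-4575`), seat `prim-quant-p1` (gen 32); memo
`run/shared/lean/prim/quant/prim-quant-p1-g32/FOR-LEAD-GATE3-CHARTC.md` §4b (chart D = corner blow-up, file LV).  Standard axioms; no sorries.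
GENERATED by `work/chartc/gen_kernel_d.py` — the chart-C kernel files XLIX, L-a..LI re-instantiated verbatim for the chart-D tables (`kit/chartC/dspec.py`).

`ChartD.sound`: `check d = true` ⟹ the chart-D system (hypothesis `hD` of `Gate3.red8_of_chartD`, file LV) is infeasible at every `(σ, u, ε, θ)` of the
box with `0 < σ`, `0 < u`, `σu ≤ 1`, `0 < ε ≤ 1`, `0 < θ ≤ 1`.
[this work].
-/

noncomputable section

namespace Summit.CriticalPhenomena.PercolationContinuityZ3.Theorems

namespace Quant

namespace ChartD

open BoxPoly4 BoxCert

/-- **Soundness of the chart-D checker.** [this work] -/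
theorem sound (d : Cert) (hchk : check d = true) (σ u ε θ : ℝ) (hσ0 : 0 < σ) (hu0 : 0 < u) (hσu : σ * u ≤ 1)
    (hε0 : 0 < ε) (hε1 : ε ≤ 1) (hθ0 : 0 < θ) (hθ1 : θ ≤ 1)
    (hS0 : (d.S0 : ℝ) ≤ d.D * σ) (hS1 : (d.D : ℝ) * σ ≤ d.S1) (hT0 : (d.T0 : ℝ) ≤ d.D * u) (hT1 : (d.D : ℝ) * u ≤ d.T1)
    (hU0 : (d.U0 : ℝ) ≤ d.D * ε) (hU1 : (d.D : ℝ) * ε ≤ d.U1) (hV0 : (d.V0 : ℝ) ≤ d.D * θ) (hV1 : (d.D : ℝ) * θ ≤ d.V1) :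
    ∀ (a0 a1 At B1 B2 c0 c1 D : ℝ), 0 ≤ a0 → 0 ≤ a1 → 0 ≤ At → 0 ≤ B1 → 0 ≤ B2 → 0 ≤ c0 → 0 ≤ c1 → 0 ≤ D →
        0 ≤ (σ * D * (a0 + a1 + σ * u * (ε * θ * At)) - B1 * (u * B2 + (c0 + c1))) →
        0 ≤ (σ * D * (a0 + a1 + σ * u * (ε * θ * At)) - B2 * (u * B1 + (c0 + c1))) →
        0 ≤ (σ * D * (a0 + a1 + σ * u * (ε * θ * At)) - (c0 + c1) * (B1 + B2)) →
        0 ≤ (σ * D * (a0 + u * B1 + u * B2 + c0) - B1 * (a1 + σ * u * (ε * θ * At) + c1 + σ * u * D)) →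
        0 ≤ (σ * D * (a0 + u * B1 + u * B2 + c0) - B2 * (a1 + σ * u * (ε * θ * At) + c1 + σ * u * D)) →
        0 ≤ ((c1 + σ * u * D) * (a0 + u * B1 + u * B2 + c0) - c0 * (a1 + σ * u * (ε * θ * At) + c1 + σ * u * D)) →
        0 < ε * a0 + (-(1 - σ * u)) * At + ε * c0 + (-((1 - σ * u) * ε)) * D →
        0 < (-(σ * (1 - θ * ε))) * a0 + (-σ) * a1 + (-(σ * θ * (1 - σ * u * (1 - ε)))) * At + (1 - σ * u) * B1 + (-(1 - (1 - σ * u) * (θ * ε))) * B2 + (-(σ * ε * θ)) * c1 →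
        0 < (-(σ * (1 - ε))) * a0 + (-σ) * a1 + (-(σ * (1 - σ * u * (1 - θ * ε)))) * At + (-(1 - (1 - σ * u) * ε)) * B1 + (1 - σ * u) * B2 + (-(σ * ε)) * c1 →
        0 < (-(σ * (1 - ε) * (θ * ε))) * a0 + (1 - σ * u * (1 - θ * ε) - σ * θ * ε) * a1 + (-((σ * u + (1 - σ * u) * (1 - ε)) * (θ * ε))) * B1 + (-((σ * u + (1 - σ * u) * (1 - θ * ε)) * ε)) * B2 + (1 - σ * u * (1 - ε * ε * θ) - σ * (ε * ε * θ)) * c1 →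
        0 < (σ * u * (3 - ε - θ * ε) + σ * (1 - θ * ε) - 2) * a0 + (σ * u * (2 - ε) + σ * (1 - θ * ε) - 1) * a1 + (ε * θ * (σ * (σ * u * u * (3 - ε - θ * ε) + 1 - 2 * u))) * At + ((σ * u + (1 - σ * u) * (1 - ε)) * (1 - θ * ε) * (1 + u) - (1 - σ * u) * ε * u) * B1 + ((σ * u + (1 - σ * u) * (1 - θ * ε)) * (1 - ε) * (1 + u) - (1 - σ * u) * (θ * ε) * u) * B2 + (σ * u + (σ + 2 * (σ * u)) * (1 - ε * ε * θ) - 2) * c0 + (σ * u + (σ + σ * u) * (1 - ε * ε * θ) - 1) * c1 + (σ + σ * u - σ * u * ((1 - σ * u) * (ε * ε * θ))) * D →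
        False := by
  simp only [check, Bool.and_eq_true, decide_eq_true_eq, List.all_eq_true] at hchk
  obtain ⟨⟨⟨hbox, hent⟩, hposB⟩, hctrl⟩ := hchk
  obtain ⟨hD, -, -, -, -⟩ := hbox
  have hent' : ∀ e ∈ d.entries, entryOk e = true := hent
  apply certDu σ u ε θ hσ0.le hu0.le hσu hε0.le hε1 hθ0.le hθ1 (lamL d.entries σ u ε θ) (nuL d.entries σ u ε θ)
    (lamL_nonneg d.entries σ u ε θ hσ0.le hu0.le hε0.le hθ0.le) (nuL_nonneg d.entries σ u ε θ hσ0.le hu0.le hε0.le hθ0.le)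
  · -- positivity
    simp only [posOk, List.any_eq_true, decide_eq_true_eq] at hposB
    obtain ⟨e, he, hk4, hidx, hmu⟩ := hposB
    have hwt : 0 < wt e σ u ε θ := by
      unfold wt
      have := mval_pos e.mono σ u ε θ hσ0 hu0 hε0 hθ0
      have hmu' : (0 : ℝ) < e.mu := by exact_mod_cast hmu
      positivity
    have hnn := lamL_nonneg d.entries σ u ε θ hσ0.le hu0.le hε0.le hθ0.le
    have key : ∀ (i : Fin 5) (x : Fin 8), e.kind = i.val → e.idx = x.val → wt e σ u ε θ ≤ lamL d.entries σ u ε θ i x := by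
      intro i x hi hx
      unfold lamL
      have hmem : wt e σ u ε θ ∈ (d.entries.map fun e' => if e'.kind = i.val ∧ e'.idx = x.val then wt e' σ u ε θ else 0) := by
        rw [List.mem_map]; exact ⟨e, he, by rw [if_pos ⟨hi, hx⟩]⟩
      apply List.single_le_sum _ _ hmem
      intro y hy
      rw [List.mem_map] at hy
      obtain ⟨e', -, rfl⟩ := hy
      split_ifs
      · exact wt_nonneg e' σ u ε θ hσ0.le hu0.le hε0.le hθ0.le
      · exact le_rfl
    have h03 := hnn 0 3; have h13 := hnn 1 3; have h23 := hnn 2 3; have h33 := hnn 3 3; have h43 := hnn 4 3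
    have h04 := hnn 0 4; have h14 := hnn 1 4; have h24 := hnn 2 4; have h34 := hnn 3 4; have h44 := hnn 4 4
    interval_cases hk : e.kind <;> rcases hidx with hx | hx
    all_goals first
      | (have := key 0 3 rfl hx; linarith) | (have := key 0 4 rfl hx; linarith)
      | (have := key 1 3 rfl hx; linarith) | (have := key 1 4 rfl hx; linarith)
      | (have := key 2 3 rfl hx; linarith) | (have := key 2 4 rfl hx; linarith)
      | (have := key 3 3 rfl hx; linarith) | (have := key 3 4 rfl hx; linarith)
      | (have := key 4 3 rfl hx; linarith) | (have := key 4 4 rfl hx; linarith)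
  · -- the 36 conditions
    intro c c' hle
    have hge : c.val ≤ c'.val := hle
    have hcc := hctrl c (List.mem_finRange c) c' (List.mem_finRange c')
    simp only [Bool.or_eq_true, decide_eq_true_eq] at hcc
    rcases hcc with hbad | hnp
    · exact absurd hbad (not_lt.2 hge)
    · rw [V81.nonpos_iff, V81.toP4_ctrl, toP4_polyOfV d c c'] at hnp
      have hev := eval_nonpos_of_ctrl_int (d.S0 : ℤ) d.S1 d.T0 d.T1 d.U0 d.U1 d.V0 d.V1 d.D (polyOf d c c') (by exact_mod_cast hD) hnp
        σ u ε θ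
        (by push_cast; linarith) (by push_cast; linarith) (by push_cast; linarith) (by push_cast; linarith)
        (by push_cast; linarith) (by push_cast; linarith) (by push_cast; linarith) (by push_cast; linarith)
      rw [eval_polyOf d hent' c c' σ u ε θ] at hev
      exact hev


end ChartD

end Quant

end Summit.CriticalPhenomena.PercolationContinuityZ3.Theorems
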